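import Literature.NumberTheory.Transcendental.RoySmallValueDeterminant
import Literature.NumberTheory.Transcendental.RoySmallValueFiniteZeros
import Literature.NumberTheory.Transcendental.RoySmallValueLineForms
import Literature.NumberTheory.Transcendental.RoySmallValueDecomposition
import Literature.NumberTheory.Transcendental.RoySmallValuePhiNonvanishing
import Mathlib.RingTheory.Nullstellensatz
import Mathlib.Algebra.Order.Antidiag.FinsuppEquiv
import HarnessLib

/-!
# Roy's small value estimate for `𝔾ₐ × 𝔾ₘ` — the frame `(P, Q, ℓ^D)` and the zeros of `Φ(P, Q, ·)`

Topic `Literature/NumberTheory/Transcendental`. Part of the formalisation of the proof of Roy 2013,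
Theorem 1.1 (named fact `roy2013_thm_1_1`, `RoySmallValueEstimates.lean`), seat B. Source: D. Roy,
*A small value estimate for `𝔾ₐ × 𝔾ₘ`*, Mathematika 59 (2013) 333–363 = arXiv:1301.0663, §5
(Lemma 5.1, proof of Theorem 5.2) and §6 (proof of Prop. 6.4: "`Q` is relatively prime to `P`.
Then `𝒵(P, Q)` has dimension `0` … `F(R) = Res_D(P, Q, R)`").

For two coprime forms `P, Q ∈ ℂ[X]_D` (`D ≥ 1`) we fix the data of Roy's Lemma 5.1 for the
regular sequence `(P, Q, ℓ_c^D)`, where `ℓ_c = X₀ + cX₁ + c²X₂` (`c ∈ ℕ`,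
`RoySmallValueFiniteZeros.exists_lineForm_ne_zero`) is a RATIONAL line avoiding the common zeros
of `P, Q` (rationality is what makes the normalisation `ℓ_c = 1` of the common zeros
Galois-equivariant and `ℓ_c^D` an integer point of the coefficient space later on); its regularity
is the parallel seat's `RoySmallValueLineForms.lineForm_pow_mul_mem_span_pair`
(`frameLine c = lineForm (-c) (-c²)`). Then: monomial complements `S₁` of `(P)_{2D}` and `S₂` of
`(P, Q)_{2D}` in `ℂ[X]_{2D}` (`RoySmallValueHilbert.exists_monomial_complement`), packaged as
`FrameData`, and for the determinant `Φ` of `RoySmallValueDeterminant.lean`: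

* `card_mon` — `#Mon n = binom(n+2, 2)`; `FrameData.card_eq` — as many columns as rows
  (`finrank_span_monomials` from the parallel seat's `RoySmallValuePhiNonvanishing.lean`);
* `linearIndependent_colFamily` — for `R ∈ ℂ[X]_D` regular modulo `(P, Q)` the polynomials
  `X^ν P (|ν| = 2D), X^ν Q (ν ∈ S₁), X^ν R (ν ∈ S₂)` are linearly independent (Lemma 5.1);
* `regular_of_no_common_zero` — a form `R` without common zero with `P, Q` is regular modulo
  `(P, Q)` (Nullstellensatz: `ℓ_c^M ∈ (P, Q, R)`, and `ℓ_c` is regular);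
* `phi_frame_ne_zero` — `Φ(P, Q, ℓ_c^D) ≠ 0`;
* **`phi_eq_zero_iff`** — for `R ∈ ℂ[X]_D`: `Φ(P, Q, R) = 0` iff `P, Q, R` have a common zero in
  `ℙ²(ℂ)` (the property "`Res_D(P₀, …, P_t) = 0` iff common zero on `Z`" of Chow forms, §2, for
  `Φ`).

Everything is proved; `FrameData` is a structure of data with proofs; no named facts.

## References

* [Roy2013] D. Roy, *A small value estimate for 𝔾ₐ × 𝔾ₘ*, Mathematika 59 (2013), 333–363
  (arXiv:1301.0663), §2 (Chow forms and their zeros), §5 Lemma 5.1, proof of Thm 5.2, §6 proof of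
  Prop. 6.4.
-/

noncomputable section

open MvPolynomial Finset Matrix Module

namespace Literature.NumberTheory.Transcendental

namespace Roy2013

/-! ### The rational frame line `ℓ_c` -/

/-- The line `ℓ_c = X₀ + c X₁ + c² X₂` (`c ∈ ℕ`). [cite: Roy2013, §6, proof of Prop. 6.4 (a linear form not vanishing on `𝒵(P,Q)`)] -/
def frameLine (c : ℕ) : CX := X 0 + C (c : ℂ) * X 1 + C ((c : ℂ) ^ 2) * X 2

/-- `ℓ_c` is the `lineForm (-c) (-c²)` of `RoySmallValueLineForms`. [folklore] -/
theorem frameLine_eq (c : ℕ) : frameLine c = lineForm (-(c : ℂ)) (-((c : ℂ) ^ 2)) := by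
  simp only [frameLine, lineForm, map_neg]; ring

/-- The value of `ℓ_c`. [folklore] -/
theorem aeval_frameLine (c : ℕ) (α : Fin 3 → ℂ) :
    aeval α (frameLine c) = α 0 + c * α 1 + (c : ℂ) ^ 2 * α 2 := by
  simp only [frameLine, map_add, map_mul, aeval_X, aeval_C, Algebra.algebraMap_self_apply]

/-- `ℓ_c^D ∈ ℂ[X]_D`. [folklore] -/
theorem isHomogeneous_frameLine_pow (c D : ℕ) : (frameLine c ^ D).IsHomogeneous D := by
  have h1 : (frameLine c).IsHomogeneous 1 :=
    ((isHomogeneous_X ℂ 0).add (isHomogeneous_C_mul_X _ 1)).add (isHomogeneous_C_mul_X _ 2)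
  simpa using h1.pow D

/-- **`ℓ_c^n` is a non-zero-divisor modulo `(P, Q)`** when `ℓ_c` avoids the common zeros of the
forms `P, Q` of degree `D ≥ 1` — a corollary of `lineForm_pow_mul_mem_span_pair`.
[cite: Roy2013, §5, proof of Thm 5.2 (regular sequence `(P, Q, R)`)] -/
theorem frameLine_pow_regular (c : ℕ) {P Q : CX} {D : ℕ} (hD : 0 < D) (hP : P.IsHomogeneous D)
    (hQ : Q.IsHomogeneous D)
    (hc : ∀ α : Fin 3 → ℂ, α ≠ 0 → aeval α P = 0 → aeval α Q = 0 → aeval α (frameLine c) ≠ 0)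
    (n : ℕ) (A : CX) (hA : frameLine c ^ n * A ∈ Ideal.span {P, Q}) : A ∈ Ideal.span {P, Q} := by
  rw [frameLine_eq] at hA hc
  refine lineForm_pow_mul_mem_span_pair _ _ hP hQ hD (fun α hα hPα hQα => ?_) n hA
  have e : ∀ f : CX, aeval α f = eval α f := fun f => DFunLike.congr_fun (coe_aeval_eq_eval α) f
  rw [← e]
  exact hc α hα ((e P).trans hPα) ((e Q).trans hQα)

/-- **A regular frame exists**: some `ℓ_c` (`c ∈ ℕ`) avoids the finitely many common zeros of two
coprime forms `P, Q ∈ ℂ[X]_D`, and then `ℓ_c^D` is regular modulo `(P, Q)`.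
[cite: Roy2013, §5, proof of Thm 5.2; §6, proof of Prop. 6.4] -/
theorem exists_regular_frameLine_pow {P Q : CX} {D : ℕ} (hD : 0 < D) (hP : P.IsHomogeneous D)
    (hQ : Q.IsHomogeneous D) (hPQ : IsRelPrime P Q) :
    ∃ c : ℕ, (∀ α : Fin 3 → ℂ, α ≠ 0 → aeval α P = 0 → aeval α Q = 0 → aeval α (frameLine c) ≠ 0) ∧
      ∀ A : CX, frameLine c ^ D * A ∈ Ideal.span {P, Q} → A ∈ Ideal.span {P, Q} := by
  obtain ⟨c, hc⟩ := exists_lineForm_ne_zero hP hQ hPQ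
  have hc' : ∀ α : Fin 3 → ℂ, α ≠ 0 → aeval α P = 0 → aeval α Q = 0 → aeval α (frameLine c) ≠ 0 :=
    fun α hα hPα hQα => by rw [aeval_frameLine]; exact hc α hα hPα hQα
  exact ⟨c, hc', frameLine_pow_regular c hD hP hQ hc' D⟩

/-! ### Cardinalities -/

/-- `#Mon n = binom(n+2, 2)` (stars and bars). [folklore] -/
theorem card_mon (n : ℕ) : Fintype.card (Mon n) = (n + 2).choose 2 := by
  classical
  rw [Fintype.card_of_subtype ((univ : Finset (Fin 3)).finsuppAntidiag n) (fun μ => by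
      rw [mem_finsuppAntidiag, Finsupp.degree_eq_sum]
      exact ⟨fun h => h.1, fun h => ⟨h, subset_univ _⟩⟩),
    Finset.card_finsuppAntidiag_nat_eq_choose, Finset.card_univ, Fintype.card_fin,
    show 3 + n - 1 = n + 2 by omega, Nat.choose_symm_add]

/-! ### The frame data -/

/-- The data of Roy's Lemma 5.1 for the regular sequence `(P, Q, ℓ_c^D)`: a line `ℓ_c` avoiding
the common zeros of `P, Q` (so that `ℓ_c^n` is regular modulo `(P, Q)`), and monomial complements
`S₁` of `(P)_{2D}`, `S₂` of `(P,Q)_{2D}` in `ℂ[X]_{2D}`. [cite: Roy2013, §5, Lemma 5.1] -/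
structure FrameData (D : ℕ) (P Q : CX) where
  /-- the line `ℓ_c` -/
  c : ℕ
  /-- exponents spanning a complement of `(P)_{2D}` -/
  S₁ : Finset (Fin 3 →₀ ℕ)
  /-- exponents spanning a complement of `(P, Q)_{2D}` -/
  S₂ : Finset (Fin 3 →₀ ℕ)
  hc : ∀ α : Fin 3 → ℂ, α ≠ 0 → aeval α P = 0 → aeval α Q = 0 → aeval α (frameLine c) ≠ 0
  hreg : ∀ (n : ℕ) (A : CX), frameLine c ^ n * A ∈ Ideal.span {P, Q} → A ∈ Ideal.span {P, Q}
  hS₁ : ∀ ν ∈ S₁, ν.degree = 2 * D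
  hS₂ : ∀ ν ∈ S₂, ν.degree = 2 * D
  hE₁i : Submodule.span ℂ ((fun μ => monomial μ (1 : ℂ)) '' (S₁ : Set (Fin 3 →₀ ℕ))) ⊓
    (homogeneousSubmodule (Fin 3) ℂ D).map (LinearMap.mulLeft ℂ P) = ⊥
  hE₁s : Submodule.span ℂ ((fun μ => monomial μ (1 : ℂ)) '' (S₁ : Set (Fin 3 →₀ ℕ))) ⊔
    (homogeneousSubmodule (Fin 3) ℂ D).map (LinearMap.mulLeft ℂ P) =
      homogeneousSubmodule (Fin 3) ℂ (2 * D)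
  hE₂i : Submodule.span ℂ ((fun μ => monomial μ (1 : ℂ)) '' (S₂ : Set (Fin 3 →₀ ℕ))) ⊓
    ((homogeneousSubmodule (Fin 3) ℂ D).map (LinearMap.mulLeft ℂ P) ⊔
      (homogeneousSubmodule (Fin 3) ℂ D).map (LinearMap.mulLeft ℂ Q)) = ⊥
  hE₂s : Submodule.span ℂ ((fun μ => monomial μ (1 : ℂ)) '' (S₂ : Set (Fin 3 →₀ ℕ))) ⊔
    ((homogeneousSubmodule (Fin 3) ℂ D).map (LinearMap.mulLeft ℂ P) ⊔
      (homogeneousSubmodule (Fin 3) ℂ D).map (LinearMap.mulLeft ℂ Q)) =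
      homogeneousSubmodule (Fin 3) ℂ (2 * D)

/-- **Existence of the frame data** for coprime forms `P, Q ∈ ℂ[X]_D`, `D ≥ 1`.
[cite: Roy2013, §5, Lemma 5.1 and proof of Thm 5.2] -/
theorem exists_frameData {D : ℕ} (hD : 0 < D) {P Q : CX} (hP : P.IsHomogeneous D)
    (hQ : Q.IsHomogeneous D) (hPQ : IsRelPrime P Q) : Nonempty (FrameData D P Q) := by
  obtain ⟨c, hc, -⟩ := exists_regular_frameLine_pow hD hP hQ hPQ
  have hW₀ : (homogeneousSubmodule (Fin 3) ℂ D).map (LinearMap.mulLeft ℂ P) ≤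
      homogeneousSubmodule (Fin 3) ℂ (2 * D) := by rw [two_mul]; exact map_mulLeft_le hP D
  have hW₁ : (homogeneousSubmodule (Fin 3) ℂ D).map (LinearMap.mulLeft ℂ P) ⊔
      (homogeneousSubmodule (Fin 3) ℂ D).map (LinearMap.mulLeft ℂ Q) ≤
      homogeneousSubmodule (Fin 3) ℂ (2 * D) := by
    refine sup_le hW₀ ?_
    rw [two_mul]; exact map_mulLeft_le hQ D
  obtain ⟨S₁, hS₁, hE₁i, hE₁s⟩ := exists_monomial_complement (2 * D) _ hW₀
  obtain ⟨S₂, hS₂, hE₂i, hE₂s⟩ := exists_monomial_complement (2 * D) _ hW₁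
  exact ⟨⟨c, S₁, S₂, hc, fun n => frameLine_pow_regular c hD hP hQ hc n, hS₁, hS₂, hE₁i, hE₁s,
    hE₂i, hE₂s⟩⟩

namespace FrameData

variable {D : ℕ} {P Q : CX}

/-- The span of the `S₁`-monomials lies in `ℂ[X]_{2D}`. [cite: Roy2013, §5, Lemma 5.1] -/
theorem span₁_le (fd : FrameData D P Q) :
    Submodule.span ℂ ((fun μ => monomial μ (1 : ℂ)) '' (fd.S₁ : Set (Fin 3 →₀ ℕ))) ≤
      homogeneousSubmodule (Fin 3) ℂ (2 * D) := by
  rw [← fd.hE₁s]; exact le_sup_left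

/-- The span of the `S₂`-monomials lies in `ℂ[X]_{2D}`. [cite: Roy2013, §5, Lemma 5.1] -/
theorem span₂_le (fd : FrameData D P Q) :
    Submodule.span ℂ ((fun μ => monomial μ (1 : ℂ)) '' (fd.S₂ : Set (Fin 3 →₀ ℕ))) ≤
      homogeneousSubmodule (Fin 3) ℂ (2 * D) := by
  rw [← fd.hE₂s]; exact le_sup_left

/-- **Lemma 5.1 for the frame**: for `R ∈ ℂ[X]_D` regular modulo `(P, Q)`, the map
`(A₀, A₁, A₂) ↦ A₀P + A₁Q + A₂R` is injective on `ℂ[X]_{2D} × E₁ × E₂` with image `ℂ[X]_{3D}`,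
and `dim E₂ = D²`. [cite: Roy2013, Lemma 5.1] -/
theorem lemma_5_1' (fd : FrameData D P Q) (hP : P.IsHomogeneous D) (hQ : Q.IsHomogeneous D)
    (hP0 : P ≠ 0) (hQ0 : Q ≠ 0) (hPQ : IsRelPrime P Q) {R : CX} (hR : R.IsHomogeneous D)
    (hRreg : ∀ f : CX, R * f ∈ Ideal.span {P, Q} → f ∈ Ideal.span {P, Q}) :
    LinearMap.ker (decompMap D P Q R
        (Submodule.span ℂ ((fun μ => monomial μ (1 : ℂ)) '' (fd.S₁ : Set (Fin 3 →₀ ℕ))))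
        (Submodule.span ℂ ((fun μ => monomial μ (1 : ℂ)) '' (fd.S₂ : Set (Fin 3 →₀ ℕ))))) = ⊥ ∧
      LinearMap.range (decompMap D P Q R
        (Submodule.span ℂ ((fun μ => monomial μ (1 : ℂ)) '' (fd.S₁ : Set (Fin 3 →₀ ℕ))))
        (Submodule.span ℂ ((fun μ => monomial μ (1 : ℂ)) '' (fd.S₂ : Set (Fin 3 →₀ ℕ))))) =
        homogeneousSubmodule (Fin 3) ℂ (3 * D) ∧
      finrank ℂ (Submodule.span ℂ ((fun μ => monomial μ (1 : ℂ)) '' (fd.S₂ : Set (Fin 3 →₀ ℕ))) :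
        Submodule ℂ CX) = D ^ 2 :=
  lemma_5_1 hP hQ hR hP0 hQ0
    (fun _ hf => Ideal.mem_span_singleton.mpr (hPQ.dvd_of_dvd_mul_left (Ideal.mem_span_singleton.mp hf)))
    hRreg fd.span₁_le fd.hE₁i fd.hE₁s fd.span₂_le fd.hE₂i fd.hE₂s

/-- **As many columns as rows**: `#Mon(2D) + #S₁ + #S₂ = #Mon(3D)`. [cite: Roy2013, Lemma 5.1] -/
theorem card_eq (fd : FrameData D P Q) (hP : P.IsHomogeneous D)
    (hQ : Q.IsHomogeneous D) (hP0 : P ≠ 0) (hQ0 : Q ≠ 0) (hPQ : IsRelPrime P Q) :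
    Fintype.card (Mon (2 * D) ⊕ (fd.S₁ ⊕ fd.S₂)) = Fintype.card (Mon (3 * D)) := by
  classical
  obtain ⟨hker, hrange, -⟩ := fd.lemma_5_1' hP hQ hP0 hQ0 hPQ (isHomogeneous_frameLine_pow fd.c D)
    (fd.hreg D)
  set E₁ : Submodule ℂ CX := Submodule.span ℂ ((fun μ => monomial μ (1 : ℂ)) '' (fd.S₁ : Set (Fin 3 →₀ ℕ)))
  set E₂ : Submodule ℂ CX := Submodule.span ℂ ((fun μ => monomial μ (1 : ℂ)) '' (fd.S₂ : Set (Fin 3 →₀ ℕ)))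
  haveI : ∀ n, FiniteDimensional ℂ (homogeneousSubmodule (Fin 3) ℂ n) :=
    finite_homogeneousSubmodule_fin_three
  haveI : FiniteDimensional ℂ E₁ := Submodule.finiteDimensional_of_le fd.span₁_le
  haveI : FiniteDimensional ℂ E₂ := Submodule.finiteDimensional_of_le fd.span₂_le
  have hdim := LinearMap.finrank_range_of_inj (LinearMap.ker_eq_bot.mp hker)
  rw [hrange, finrank_prod, finrank_prod, finrank_homogeneousSubmodule_fin_three,
    finrank_homogeneousSubmodule_fin_three, finrank_span_monomials, finrank_span_monomials] at hdim
  rw [Fintype.card_sum, Fintype.card_sum, Fintype.card_coe, Fintype.card_coe, card_mon, card_mon]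
  omega

end FrameData

variable {D : ℕ} {P Q : CX}

/-! ### Linear independence of the columns (Lemma 5.1) -/

/-- The coefficients of a combination of distinct monomials. [folklore] -/
theorem coeff_sum_smul_monomial_subtype {ι : Type*} [Fintype ι] (v : ι → Fin 3 →₀ ℕ)
    (hv : Function.Injective v) (g : ι → ℂ) (i : ι) :
    coeff (v i) (∑ j, g j • (monomial (v j) (1 : ℂ) : CX)) = g i := by
  classical
  rw [coeff_sum]
  simp_rw [coeff_smul, coeff_monomial, smul_eq_mul, mul_ite, mul_one, mul_zero]
  rw [Finset.sum_eq_single i]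
  · rw [if_pos rfl]
  · intro j _ hji
    rw [if_neg]
    intro h
    exact hji (hv h)
  · intro h; exact absurd (mem_univ i) h

/-- A combination of monomials with exponents in `S` lies in their span. [folklore] -/
theorem sum_smul_monomial_mem_span (S : Finset (Fin 3 →₀ ℕ)) (g : S → ℂ) :
    ∑ ν : S, g ν • (monomial ν.1 (1 : ℂ) : CX) ∈
      Submodule.span ℂ ((fun μ => monomial μ (1 : ℂ)) '' (S : Set (Fin 3 →₀ ℕ))) :=
  Submodule.sum_mem _ fun ν _ => Submodule.smul_mem _ _
    (Submodule.subset_span ⟨ν.1, ν.2, rfl⟩)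

/-- A combination of monomials of degree `n` lies in `ℂ[X]_n`. [folklore] -/
theorem sum_smul_monomial_mem_homogeneousSubmodule (n : ℕ) (g : Mon n → ℂ) :
    ∑ ν : Mon n, g ν • (monomial ν.1 (1 : ℂ) : CX) ∈ homogeneousSubmodule (Fin 3) ℂ n :=
  Submodule.sum_mem _ fun ν _ => Submodule.smul_mem _ _
    ((mem_homogeneousSubmodule _ _).mpr (isHomogeneous_monomial _ ν.2))

/-- **Linear independence of the columns of `M_{(P,Q,R)}`** for `R ∈ ℂ[X]_D` regular modulo
`(P, Q)` (Roy's Lemma 5.1: `φ_{(P,Q,R)}` is injective on `ℂ[X]_{2D} × E₁ × E₂`).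
[cite: Roy2013, Lemma 5.1] -/
theorem linearIndependent_colFamily (fd : FrameData D P Q) (hP : P.IsHomogeneous D)
    (hQ : Q.IsHomogeneous D) (hP0 : P ≠ 0) (hQ0 : Q ≠ 0) (hPQ : IsRelPrime P Q) {R : CX}
    (hR : R.IsHomogeneous D)
    (hRreg : ∀ f : CX, R * f ∈ Ideal.span {P, Q} → f ∈ Ideal.span {P, Q}) :
    LinearIndependent ℂ (colFamily D fd.S₁ fd.S₂ ![P, Q, R]) := by
  classical
  obtain ⟨hker, -, -⟩ := fd.lemma_5_1' hP hQ hP0 hQ0 hPQ hR hRreg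
  rw [Fintype.linearIndependent_iff]
  intro g hg
  -- the three components
  set A₀ : CX := ∑ ν : Mon (2 * D), g (Sum.inl ν) • monomial ν.1 (1 : ℂ) with hA₀
  set A₁ : CX := ∑ ν : fd.S₁, g (Sum.inr (Sum.inl ν)) • monomial ν.1 (1 : ℂ) with hA₁
  set A₂ : CX := ∑ ν : fd.S₂, g (Sum.inr (Sum.inr ν)) • monomial ν.1 (1 : ℂ) with hA₂
  have hA₀m : A₀ ∈ homogeneousSubmodule (Fin 3) ℂ (2 * D) :=
    sum_smul_monomial_mem_homogeneousSubmodule _ _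
  have hA₁m := sum_smul_monomial_mem_span fd.S₁ (fun ν => g (Sum.inr (Sum.inl ν)))
  have hA₂m := sum_smul_monomial_mem_span fd.S₂ (fun ν => g (Sum.inr (Sum.inr ν)))
  -- `A₀ P + A₁ Q + A₂ R = ∑ g • fam = 0`
  have hsum : A₀ * P + (A₁ * Q + A₂ * R) = 0 := by
    rw [← hg, Fintype.sum_sum_type, Fintype.sum_sum_type, hA₀, hA₁, hA₂, Finset.sum_mul,
      Finset.sum_mul, Finset.sum_mul]
    simp only [colFamily, smul_mul_assoc, Matrix.cons_val_zero, Matrix.cons_val_one,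
      Matrix.cons_val_two, Matrix.head_cons, Matrix.tail_cons]
  have hzero : decompMap D P Q R
      (Submodule.span ℂ ((fun μ => monomial μ (1 : ℂ)) '' (fd.S₁ : Set (Fin 3 →₀ ℕ))))
      (Submodule.span ℂ ((fun μ => monomial μ (1 : ℂ)) '' (fd.S₂ : Set (Fin 3 →₀ ℕ))))
      (⟨A₀, hA₀m⟩, ⟨A₁, hA₁m⟩, ⟨A₂, hA₂m⟩) = 0 := by
    rw [decompMap_apply]; exact hsum
  have hmem := LinearMap.mem_ker.mpr hzero
  rw [hker, Submodule.mem_bot, Prod.mk_eq_zero, Prod.mk_eq_zero] at hmem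
  obtain ⟨h0, h1, h2⟩ := hmem
  have hA₀0 : A₀ = 0 := congr_arg Subtype.val h0
  have hA₁0 : A₁ = 0 := congr_arg Subtype.val h1
  have hA₂0 : A₂ = 0 := congr_arg Subtype.val h2
  intro c
  rcases c with ν | ν | ν
  · have := coeff_sum_smul_monomial_subtype (fun ν : Mon (2 * D) => ν.1) Subtype.val_injective
      (fun ν => g (Sum.inl ν)) ν
    rwa [← hA₀, hA₀0, coeff_zero, eq_comm] at this
  · have := coeff_sum_smul_monomial_subtype (fun ν : fd.S₁ => ν.1) Subtype.val_injective
      (fun ν => g (Sum.inr (Sum.inl ν))) ν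
    rwa [← hA₁, hA₁0, coeff_zero, eq_comm] at this
  · have := coeff_sum_smul_monomial_subtype (fun ν : fd.S₂ => ν.1) Subtype.val_injective
      (fun ν => g (Sum.inr (Sum.inr ν))) ν
    rwa [← hA₂, hA₂0, coeff_zero, eq_comm] at this

/-! ### Regularity from the absence of common zeros -/

/-- **A form without common zero with `P, Q` is regular modulo `(P, Q)`**: by the
Nullstellensatz `ℓ_c^M ∈ (P, Q, R)`, and `ℓ_c^M` is regular. (Roy: "as the elements of `ℂ[X]_D`
have no common zeros in `ℙ^m(ℂ)`, this sequence can be extended to a regular sequence".)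
[cite: Roy2013, §5, proof of Thm 5.2] -/
theorem regular_of_no_common_zero (fd : FrameData D P Q) {R : CX}
    (hnz : ∀ α : Fin 3 → ℂ, α ≠ 0 → aeval α P = 0 → aeval α Q = 0 → aeval α R ≠ 0)
    (f : CX) (hf : R * f ∈ Ideal.span {P, Q}) : f ∈ Ideal.span {P, Q} := by
  set I : Ideal CX := Ideal.span {P, Q, R} with hI
  -- the affine zero locus of `(P, Q, R)` is `{0}`
  have hzl : ∀ x ∈ zeroLocus ℂ I, x = 0 := by
    intro x hx
    rw [mem_zeroLocus_iff] at hx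
    by_contra hx0
    exact hnz x hx0 (hx P (Ideal.subset_span (by simp))) (hx Q (Ideal.subset_span (by simp)))
      (hx R (Ideal.subset_span (by simp)))
  -- `ℓ_c` vanishes there, so `ℓ_c^M ∈ I`
  have hℓ : frameLine fd.c ∈ vanishingIdeal ℂ (zeroLocus ℂ I) := by
    rw [mem_vanishingIdeal_iff]
    intro x hx
    rw [hzl x hx, aeval_frameLine]
    simp
  rw [vanishingIdeal_zeroLocus_eq_radical] at hℓ
  obtain ⟨M, hM⟩ := hℓ
  -- `ℓ^M = z + y R` with `z ∈ (P, Q)`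
  rw [hI, show ({P, Q, R} : Set CX) = insert R {P, Q} by
      ext x; simp only [Set.mem_insert_iff, Set.mem_singleton_iff]; tauto,
    Ideal.span_insert, Submodule.mem_sup] at hM
  obtain ⟨y, hy, z, hz, hyz⟩ := hM
  obtain ⟨a, rfl⟩ := Ideal.mem_span_singleton'.mp hy
  refine fd.hreg M f ?_
  rw [← hyz, add_mul, mul_assoc]
  exact Ideal.add_mem _ (Ideal.mul_mem_left _ _ hf) (Ideal.mul_mem_right _ _ hz)

/-! ### Zeros of `Φ(P, Q, ·)` -/

/-- **`Φ(P, Q, ℓ_c^D) ≠ 0`.** [cite: Roy2013, §5, proof of Thm 5.2 ("`Φ(P) ≠ 0`")] -/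
theorem phi_frame_ne_zero (fd : FrameData D P Q) (hP : P.IsHomogeneous D)
    (hQ : Q.IsHomogeneous D) (hP0 : P ≠ 0) (hQ0 : Q ≠ 0) (hPQ : IsRelPrime P Q)
    (h : Fintype.card (Mon (2 * D) ⊕ (fd.S₁ ⊕ fd.S₂)) = Fintype.card (Mon (3 * D))) :
    phi D fd.S₁ fd.S₂ h ![P, Q, frameLine fd.c ^ D] ≠ 0 :=
  phi_ne_zero_of_linearIndependent fd.hS₁ fd.hS₂ _
    (fun k => by fin_cases k <;> [exact hP; exact hQ; exact isHomogeneous_frameLine_pow fd.c D])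
    (linearIndependent_colFamily fd hP hQ hP0 hQ0 hPQ (isHomogeneous_frameLine_pow fd.c D) (fd.hreg D))

/-- **The zeros of `Φ(P, Q, ·)`**: for `R ∈ ℂ[X]_D`, `Φ(P, Q, R) = 0` iff `P, Q, R` have a common
zero in `ℙ²(ℂ)`. [cite: Roy2013, §2 (zeros of Chow forms), §6 proof of Prop. 6.4] -/
theorem phi_eq_zero_iff (fd : FrameData D P Q) (hP : P.IsHomogeneous D)
    (hQ : Q.IsHomogeneous D) (hP0 : P ≠ 0) (hQ0 : Q ≠ 0) (hPQ : IsRelPrime P Q) {R : CX}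
    (hR : R.IsHomogeneous D)
    (h : Fintype.card (Mon (2 * D) ⊕ (fd.S₁ ⊕ fd.S₂)) = Fintype.card (Mon (3 * D))) :
    phi D fd.S₁ fd.S₂ h ![P, Q, R] = 0 ↔
      ∃ α : Fin 3 → ℂ, α ≠ 0 ∧ aeval α P = 0 ∧ aeval α Q = 0 ∧ aeval α R = 0 := by
  constructor
  · intro h0
    by_contra hnz
    push Not at hnz
    refine phi_ne_zero_of_linearIndependent fd.hS₁ fd.hS₂ _
      (fun k => by fin_cases k <;> [exact hP; exact hQ; exact hR])
      (linearIndependent_colFamily fd hP hQ hP0 hQ0 hPQ hR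
        (regular_of_no_common_zero fd fun α hα hPα hQα => hnz α hα hPα hQα)) h0
  · rintro ⟨α, hα, hPα, hQα, hRα⟩
    exact phi_eq_zero_of_common_zero fd.hS₁ fd.hS₂ _
      (fun k => by fin_cases k <;> [exact hP; exact hQ; exact hR]) hα
      (fun k => by fin_cases k <;> [exact hPα; exact hQα; exact hRα])


end Roy2013

end Literature.NumberTheory.Transcendental
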